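import Summits.Ventures.HSemireg.PorteousConfinementLedger

/-!
# Venture HSemireg — THEOREM N″ at the (S4) rung `n = 6` (and every `n ≥ 3`), II: SPLIT PORTEOUS LOCI ARE CONFINED —
# the pair space `T^pair = ⋂ ker ⌟(differences)`, the class read-out `c_n(F′ − E′) ∈ ℚ·hⁿ` (W-DEAD), and the
# NEG-#12-shaped sentence at every rung

HONEST FRAMING.  Part of the Lean side of the computation cell `pub-hsemireg` (track «S4-PUSH» (ii), lane pen s4-prove-1,
note `run/shared/lean/pub/pub-hsemireg/s4push/prove-1/ATTEMPT-5.md`; routed residual (R-i) of corner 1: «extend th-5's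
THEOREM N″ — theory/TH5-PORTEOUS-LEMMA-N.md §5, the mechanism of the cell's signed NEGATIVE #12 at `g = 6` — to the
rung `n = 6`»).  This file is the MODEL-LEVEL kernel of that extension, in the style of the `ObstructionLocus*` files:
it proves the finite content of THEOREM N″_n / COROLLARY N″_n for EVERY `n`, with the geometric steps entering as NAMED
HYPOTHESIS SHAPES (binders of the final theorems, listed one-to-one below), and it instantiates the rung `n = 6`.
Nothing here constructs an abelian variety, a degeneracy locus, an obstruction class or a Weil class; nothing here says
that HC / HC_CM / HC_AV holds; no Literature fact is declared or used; NEGATIVE #12's signed text (g = 6) does not move.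

THE STATEMENT (ATTEMPT-5 §1; th-5 §5 with `3 ↦ n`).  `A` an abelian `2n`-fold, `E = ⊕_{a ≤ e} N_a`, `F = ⊕_{i ≤ f} M_i`,
`f = e + n − 1`, (H1) every `M_i ⊗ N_a⁻¹` ample, `φ : E → F` generic, `Z = D_{e−1}(φ)` a smooth `n`-fold, `l_a = c₁(N_a)`,
`m_i = c₁(M_i)`.  THEOREM N″_n (`n ≥ 3`): `Z ⊂ A` deforms to first order along `ξ ∈ H¹(A, T_A)` iff `ξ ⌟ δ = 0` for every
pairwise difference `δ` of the `e + f` classes `{l_a} ∪ {m_i}`; `T_Z^pair = ⋂_δ ker(⌟δ)`.  COROLLARY N″_n: on an `(n,n)`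
Weil-type component no such `Z` is simultaneously Bloch-semiregular, class-exact (`[Z] ∈ ℚhⁿ ⊕ W_K`) and W-alive
(`[Z] = c_n(F′ − E′) ∈ ℚhⁿ` after the twist by `N_1⁻¹`).  Rung `n = 6`: `f = e + 5`, Weil-type 12-folds, `[Z] ∈ H¹²`.

PROVED HERE (kernel):
* §3 THE PAIR SPACE: `pairSpace c = ⨅_{p,q} ker(c_p − c_q)`, one base letter suffices (`pairSpace_eq_iInf_base` — the twist
  by `N_1⁻¹`), and THEOREM N″'s shape `deforms_iff_mem_pairSpace`: from the named shapes (H-Step1) «`ob(ξ) = 0 ⇒` all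
  `ξ⌟l_a` equal» (Step 1 = file I's `injDeg_rel` + `diagonal_isScalar_iff` on paper inputs), (H-Step4) «`ob(ξ) = 0 ∧` all
  `ξ⌟l_a = ξ⌟l_{a₀}` `⇒` all `ξ⌟m_i = ξ⌟l_{a₀}`», (H-conv), one gets `{ob = 0} = pairSpace`.  COROLLARY shape
  `sub_mem_span_of_weil`: (H-BlochExact) «`T_W ⊆ {ob = 0}`» + (H-U2.1) «a class killed by `T_W` lies in `K∙h`» ⇒ every
  pairwise difference of the letters lies in `K∙h`.
* §4 THE CLASS READ-OUT: for ANY `Φ ∈ R⟦X⟧` with `Φ · ∏_a (1 + l′_a X) = ∏_i (1 + m′_i X)` (the total Chern series of the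
  virtual bundle `F′ − E′`; it exists and is unique, `existsUnique_virtualChern`) and all letters in `K∙h`, EVERY
  coefficient `c_k(F′ − E′)` lies in `K∙hᵏ` (`coeff_virtualChern_mem_span_pow`) — so any read-out killing `K∙hⁿ` kills
  `c_n(F′ − E′)` (`wPart_coeff_eq_zero`).
* §5 ASSEMBLY: `SplitPorteousShapes` (the named hypotheses, typed) ⇒ `not_semiregular_classExact_wAlive` = the
  NEG-#12-shaped sentence at every rung, `classZ_mem_span_pow`, and `rung_six` (`n = 6`, `f = e + 5`, with file I's ledger).

NOT LEAN (paper, ATTEMPT-5 §3–§4, th-5 §5; the docstrings name them where they enter): Kodaira's obstruction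
`ob_{Z/A}(ξ) ∈ H¹(N_{Z/A})`, naturality of connecting maps, `At(ℙ(E)/A) = At(E) mod scalars` (Atiyah 1957 Thm 5), lifting
of `ξ`-flat line bundles, `ob_{Z̃/P}` and EGA IV 19.2.4, the Atiyah-class obstruction `κ ∪ At(V|_Z) = 0` for a bundle that
follows the deformation (Illusie / Huybrechts–Thomas), Bott + index theorem behind file I's supports, Bloch 1972 (6.10)
(`π ∘ ob = ⌟[Z]`), (U2.1)_n + van Geemen 6.12 (`B¹_gen = ℚh`, `n ≥ 2`), Thom–Porteous `[D_{e−1}(φ)] = c_{f−e+1}(F − E)`.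
References (dictionary only): TH5-PORTEOUS-LEMMA-N.md b33026951e7dfe7a §5; ATTEMPT-5.md; SIGNSHEET-2000Z §4 (NEG #12
text); STRUCTURE.md §2 (S-B) rows v0.13 / v0.16; Fulton, Intersection Theory, Thm 14.4.
-/

open scoped BigOperators
open Finset

namespace Summit.Ventures.HSemireg.PorteousConfinement

/-! ## §3 The pair space and the shapes of THEOREM N″ / COROLLARY N″ -/

section PairSpace

variable {K : Type*} [CommRing K] {T : Type*} [AddCommGroup T] [Module K T] {H : Type*} [AddCommGroup H] [Module K H]
  {ι : Type*}

/-- `T^pair = ⋂_{p,q} ker(ξ ↦ ξ⌟(x_p − x_q))`: the common kernel of the contractions against all pairwise differences of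
a family of classes, given through their contraction maps `c_p : T = H¹(A,T_A) → H = H^{0,2}(A)`, `c_p ξ = ξ ⌟ x_p`. -/
def pairSpace (c : ι → T →ₗ[K] H) : Submodule K T := ⨅ p : ι, ⨅ q : ι, LinearMap.ker (c p - c q)

/-- Membership in the pair space: all contractions agree. -/
theorem mem_pairSpace_iff {c : ι → T →ₗ[K] H} {ξ : T} : ξ ∈ pairSpace c ↔ ∀ p q, c p ξ = c q ξ := by
  simp [pairSpace, Submodule.mem_iInf, LinearMap.mem_ker, sub_eq_zero]

/-- One base letter suffices: `T^pair = ⋂_q ker ⌟(x_q − x_{p₀})` — the twist by `N_1⁻¹` of th-5 Step 2 (the `e + f − 1`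
differences with `l_1` cut out the same space as all `C(e+f, 2)` of them). -/
theorem pairSpace_eq_iInf_base (c : ι → T →ₗ[K] H) (p₀ : ι) :
    pairSpace c = ⨅ q : ι, LinearMap.ker (c q - c p₀) := by
  ext ξ
  simp only [mem_pairSpace_iff, Submodule.mem_iInf, LinearMap.mem_ker, LinearMap.sub_apply, sub_eq_zero]
  exact ⟨fun h q => h q p₀, fun h p q => by rw [h p, h q]⟩

/-- A subspace (e.g. the Weil directions `T_W`) lies in the pair space iff all contractions agree on it. -/
theorem le_pairSpace_iff {c : ι → T →ₗ[K] H} (S : Submodule K T) :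
    S ≤ pairSpace c ↔ ∀ p q, ∀ ξ ∈ S, c p ξ = c q ξ :=
  ⟨fun h p q _ hξ => mem_pairSpace_iff.1 (h hξ) p q, fun h ξ hξ => mem_pairSpace_iff.2 fun p q => h p q ξ hξ⟩

variable {e f : ℕ}

/-- **The named hypothesis shapes of THEOREM N″** (th-5 §5 Steps 1–4 and the converse; ATTEMPT-5 §3), for the letters
`Fin e ⊕ Fin f` (`inl a ↦ l_a = c₁(N_a)`, `inr i ↦ m_i = c₁(M_i)`), their contraction maps `c`, the predicate
`Deforms ξ :⟺ ob_{Z/A}(ξ) = 0`, and the twisting letter `a₀` (`N_{a₀}`, th-5's `N_1`):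
* `step1` — COLUMNS: `ob_{Z/A}(ξ) = 0 ⇒ ∂ξ = 0 ⇒` all `ξ⌟l_a` equal (Step 1: naturality + `At(ℙ(E)/A) = At(E) mod
  scalars` + `diagonal_isScalar_iff` + INJ₂(T_{P/A}), `injDeg_rel`, `n ≥ 3`);
* `step4` — ROWS: if `ob_{Z/A}(ξ) = 0` and (after the twist) every `N_a` is `ξ`-flat relative to `N_{a₀}`, then every
  `M_i` is: `ξ⌟m_i = ξ⌟l_{a₀}` (Steps 2–4: `P_ξ = ℙ(E_ξ)`, `ob_{Z̃/P}(P_ξ) = 0` by row (c) + SURJ₁(T_{P/A}), regular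
  re-embedding, `κ ∪ At(V|_Z) = 0` diagonal blocks, `𝒪_{P_ξ}(1)`, INJ₂(𝒪));
* `converse` — all differences `ξ`-flat ⇒ `Z` deforms along `ξ` (lift `N_a, M_i, φ`; `D_{e−1}` commutes with base change). -/
structure StepShapes (c : Fin e ⊕ Fin f → T →ₗ[K] H) (Deforms : T → Prop) (a₀ : Fin e) : Prop where
  step1 : ∀ ξ, Deforms ξ → ∀ a b : Fin e, c (.inl a) ξ = c (.inl b) ξ
  step4 : ∀ ξ, Deforms ξ → (∀ a : Fin e, c (.inl a) ξ = c (.inl a₀) ξ) → ∀ i : Fin f, c (.inr i) ξ = c (.inl a₀) ξ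
  converse : ∀ ξ, (∀ p q, c p ξ = c q ξ) → Deforms ξ

/-- **THEOREM N″_n, shape** (th-5 §5; every `n ≥ 3` once the ledger rows are supplied): the first-order pair-deformation
space `{ξ : ob_{Z/A}(ξ) = 0}` is EXACTLY `T^pair = ⋂ ker ⌟(pairwise differences of {l_a} ∪ {m_i})`. -/
theorem deforms_iff_mem_pairSpace {c : Fin e ⊕ Fin f → T →ₗ[K] H} {Deforms : T → Prop} {a₀ : Fin e}
    (hS : StepShapes c Deforms a₀) (ξ : T) : Deforms ξ ↔ ξ ∈ pairSpace c := by
  rw [mem_pairSpace_iff]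
  refine ⟨fun hξ => ?_, hS.converse ξ⟩
  have hl : ∀ a : Fin e, c (.inl a) ξ = c (.inl a₀) ξ := fun a => hS.step1 ξ hξ a a₀
  have hm : ∀ i : Fin f, c (.inr i) ξ = c (.inl a₀) ξ := hS.step4 ξ hξ hl
  have hall : ∀ p : Fin e ⊕ Fin f, c p ξ = c (.inl a₀) ξ := by
    rintro (a | i)
    · exact hl a
    · exact hm i
  intro p q
  rw [hall p, hall q]

/-- The pair space written with the base letter `l_{a₀}` (the form th-5 states after the twist). -/
theorem deforms_iff_forall_base {c : Fin e ⊕ Fin f → T →ₗ[K] H} {Deforms : T → Prop} {a₀ : Fin e}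
    (hS : StepShapes c Deforms a₀) (ξ : T) : Deforms ξ ↔ ∀ q, c q ξ = c (.inl a₀) ξ := by
  rw [deforms_iff_mem_pairSpace hS, pairSpace_eq_iInf_base c (.inl a₀)]
  simp [Submodule.mem_iInf, sub_eq_zero]

variable {NS : Type*} [AddCommGroup NS] [Module K NS]

/-- **COROLLARY N″_n, shape, class level** (ATTEMPT-5 §4 (C1)–(C3)).  Letters `cl : Fin e ⊕ Fin f → NS` in the rational
Néron–Severi space `NS` with its contraction `contr : NS → (T → H)` (`x ↦ (ξ ↦ ξ⌟x)`), the Weil directions `TW ⊆ T`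
(`T_oS`, `n²`-dimensional) and the polarisation `h ∈ NS`.  Named shapes: (H-BlochExact) «Bloch-semiregular ∧ class-exact
⇒ every `ξ ∈ T_W` has `ob_{Z/A}(ξ) = 0`» (Bloch 1972 (6.10) with `π ∘ ob = ⌟[Z]`, and `ξ⌟[Z] = 0` on `T_W` for
`[Z] ∈ ℚhⁿ ⊕ W_K`); (H-U2.1) «a class of `NS` killed by every `ξ ∈ T_W` lies in `K∙h`» ((U2.1)_n: Cartan decomposition of
`𝔰𝔲(n,n)` + van Geemen 6.12, `n ≥ 2`).  CONCLUSION: every pairwise difference of the letters lies in `K∙h`. -/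
theorem sub_mem_span_of_weil {contr : NS →ₗ[K] T →ₗ[K] H} {cl : Fin e ⊕ Fin f → NS} {Deforms : T → Prop} {a₀ : Fin e}
    (hS : StepShapes (fun p => contr (cl p)) Deforms a₀) {TW : Submodule K T} {h : NS}
    (hBlochExact : ∀ ξ ∈ TW, Deforms ξ) (hU21 : ∀ x : NS, (∀ ξ ∈ TW, contr x ξ = 0) → x ∈ K ∙ h) (p q : Fin e ⊕ Fin f) :
    cl p - cl q ∈ K ∙ h := by
  refine hU21 _ fun ξ hξ => ?_
  have hpair := (mem_pairSpace_iff.1 ((deforms_iff_mem_pairSpace hS ξ).1 (hBlochExact ξ hξ))) p q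
  simp only [map_sub, LinearMap.sub_apply, hpair, sub_self]

/-- In particular, after the twist by `N_{a₀}⁻¹` EVERY letter `x_p − l_{a₀}` lies in `K∙h` (the input of §4). -/
theorem sub_base_mem_span_of_weil {contr : NS →ₗ[K] T →ₗ[K] H} {cl : Fin e ⊕ Fin f → NS} {Deforms : T → Prop}
    {a₀ : Fin e} (hS : StepShapes (fun p => contr (cl p)) Deforms a₀) {TW : Submodule K T} {h : NS}
    (hBlochExact : ∀ ξ ∈ TW, Deforms ξ) (hU21 : ∀ x : NS, (∀ ξ ∈ TW, contr x ξ = 0) → x ∈ K ∙ h) (p : Fin e ⊕ Fin f) :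
    cl p - cl (.inl a₀) ∈ K ∙ h :=
  sub_mem_span_of_weil hS hBlochExact hU21 p _

end PairSpace

/-! ## §4 The class read-out: `c(F′ − E′) ∈ ℚ[h]` when every letter is in `ℚh` -/

section ClassReadout

open PowerSeries

variable {K : Type*} [CommRing K] {R : Type*} [CommRing R] [Algebra K R]

/-- Total Chern series of a split bundle with letters (first Chern classes) `x_1, …, x_r ∈ R = H^{2•}(A)`:
`c(⊕ L_i) = ∏_i (1 + x_i t)`. -/
noncomputable def chernSplit {r : ℕ} (x : Fin r → R) : R⟦X⟧ := ∏ i, (1 + C (x i) * X)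

/-- `c₀ = 1`. -/
theorem constantCoeff_chernSplit {r : ℕ} (x : Fin r → R) : constantCoeff (chernSplit x) = 1 := by
  unfold chernSplit; rw [map_prod]; simp

/-- `K∙hᵃ · K∙hᵇ ⊆ K∙hᵃ⁺ᵇ`. -/
theorem mul_mem_span_pow {h x y : R} {a b : ℕ} (hx : x ∈ K ∙ h ^ a) (hy : y ∈ K ∙ h ^ b) :
    x * y ∈ K ∙ h ^ (a + b) := by
  obtain ⟨α, rfl⟩ := Submodule.mem_span_singleton.1 hx
  obtain ⟨β, rfl⟩ := Submodule.mem_span_singleton.1 hy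
  exact Submodule.mem_span_singleton.2 ⟨α * β, by rw [smul_mul_smul_comm, pow_add]⟩

/-- One letter: `coeff_k ((1 + x t)·Ψ) = coeff_k Ψ + x · coeff_{k−1} Ψ`, so membership `coeff_k ∈ K∙hᵏ` propagates. -/
theorem coeff_one_add_mul_mem {h x : R} (hx : x ∈ K ∙ h) {Ψ : R⟦X⟧} (hΨ : ∀ k, coeff k Ψ ∈ K ∙ h ^ k) (k : ℕ) :
    coeff k ((1 + C x * X) * Ψ) ∈ K ∙ h ^ k := by
  have hsplit : (1 + C x * X) * Ψ = Ψ + C x * (X * Ψ) := by ring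
  rw [hsplit, map_add, coeff_C_mul]
  refine Submodule.add_mem _ (hΨ k) ?_
  cases k with
  | zero => simp
  | succ k =>
    rw [coeff_succ_X_mul]
    simpa [add_comm] using mul_mem_span_pow (K := K) (h := h) (a := 1) (b := k) (by simpa using hx) (hΨ k)

/-- `c_k(⊕ L_i) = e_k(x) ∈ K∙hᵏ` when every letter `x_i ∈ K∙h`. -/
theorem coeff_chernSplit_mem_span_pow {r : ℕ} {x : Fin r → R} {h : R} (hx : ∀ i, x i ∈ K ∙ h) (k : ℕ) :
    coeff k (chernSplit x) ∈ K ∙ h ^ k := by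
  classical
  unfold chernSplit
  suffices hs : ∀ s : Finset (Fin r), ∀ k, coeff k (∏ i ∈ s, (1 + C (x i) * X)) ∈ K ∙ h ^ k from hs _ k
  intro s
  induction s using Finset.induction_on with
  | empty =>
    intro k
    rw [Finset.prod_empty, coeff_one]
    split_ifs with hk
    · subst hk; simp [Submodule.mem_span_singleton_self]
    · exact Submodule.zero_mem _
  | insert a s ha ih =>
    intro k
    rw [Finset.prod_insert ha]
    exact coeff_one_add_mul_mem (hx a) ih k

/-- **The virtual bundle `F′ − E′` has a unique total Chern series**: `c(E′)` has constant term `1`, hence is a unit of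
`R⟦t⟧`, so `Φ · c(E′) = c(F′)` has exactly one solution `Φ = c(F′)·c(E′)⁻¹ =: c(F′ − E′)` (the hypothesis of the next
theorem is not vacuous and pins `Φ`). -/
theorem existsUnique_virtualChern {e f : ℕ} (l : Fin e → R) (m : Fin f → R) :
    ∃! Φ : R⟦X⟧, Φ * chernSplit l = chernSplit m := by
  have hu : constantCoeff (chernSplit l) = ((1 : Rˣ) : R) := by rw [constantCoeff_chernSplit]; rfl
  have hinv : chernSplit l * invOfUnit (chernSplit l) 1 = 1 := mul_invOfUnit _ _ hu
  refine ⟨chernSplit m * invOfUnit (chernSplit l) 1, ?_, ?_⟩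
  · show chernSplit m * invOfUnit (chernSplit l) 1 * chernSplit l = chernSplit m
    rw [mul_assoc, mul_comm (invOfUnit _ _), hinv, mul_one]
  · intro Ψ hΨ
    calc Ψ = Ψ * (chernSplit l * invOfUnit (chernSplit l) 1) := by rw [hinv, mul_one]
      _ = chernSplit m * invOfUnit (chernSplit l) 1 := by rw [← mul_assoc, hΨ]

/-- **THE CLASS READ-OUT** (ATTEMPT-5 §4 (C6); th-5 COROLLARY N″ last step).  If every letter `l′_a, m′_i` lies in `K∙h`
(which is what `sub_base_mem_span_of_weil` delivers after the twist by `N_{a₀}⁻¹`), then EVERY Chern class of the virtual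
bundle `F′ − E′` lies in `K∙hᵏ`: for any `Φ` with `Φ · ∏(1 + l′_a t) = ∏(1 + m′_i t)`, `coeff_k Φ ∈ K∙hᵏ` for all `k`.
With Thom–Porteous (`[Z] = [D_{e−1}(φ′)] = c_{f−e+1}(F′ − E′) = c_n(F′ − E′)`, paper) this is `[Z] ∈ ℚhⁿ`: W-DEAD. -/
theorem coeff_virtualChern_mem_span_pow {e f : ℕ} {l : Fin e → R} {m : Fin f → R} {h : R}
    (hl : ∀ a, l a ∈ K ∙ h) (hm : ∀ i, m i ∈ K ∙ h) {Φ : R⟦X⟧} (hΦ : Φ * chernSplit l = chernSplit m) :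
    ∀ k, coeff k Φ ∈ K ∙ h ^ k := by
  intro k
  induction k using Nat.strong_induction_on with
  | _ k ih =>
    have hk : coeff k (Φ * chernSplit l) = coeff k (chernSplit m) := by rw [hΦ]
    cases k with
    | zero =>
      have h0 : coeff 0 Φ = coeff 0 (chernSplit m) := by
        simpa [coeff_zero_eq_constantCoeff, constantCoeff_chernSplit] using hk
      rw [h0]
      exact coeff_chernSplit_mem_span_pow hm 0
    | succ k =>
      rw [coeff_mul, Finset.Nat.sum_antidiagonal_succ'] at hk
      have hE0 : coeff 0 (chernSplit l) = 1 := by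
        rw [coeff_zero_eq_constantCoeff_apply, constantCoeff_chernSplit]
      rw [hE0, mul_one] at hk
      have hsolve : coeff (k + 1) Φ = coeff (k + 1) (chernSplit m)
          - ∑ p ∈ antidiagonal k, coeff p.1 Φ * coeff (p.2 + 1) (chernSplit l) := by
        rw [← hk]; ring
      rw [hsolve]
      refine Submodule.sub_mem _ (coeff_chernSplit_mem_span_pow hm _) (Submodule.sum_mem _ fun p hp => ?_)
      have hp' : p.1 + p.2 = k := Finset.HasAntidiagonal.mem_antidiagonal.1 hp
      have h1 : coeff p.1 Φ ∈ K ∙ h ^ p.1 := ih p.1 (by omega)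
      have h2 : coeff (p.2 + 1) (chernSplit l) ∈ K ∙ h ^ (p.2 + 1) := coeff_chernSplit_mem_span_pow hl _
      have := mul_mem_span_pow h1 h2
      rwa [show p.1 + (p.2 + 1) = k + 1 by omega] at this

/-- **W-part zero.**  Any `K`-linear read-out `prW : R → W` that kills the line `K∙hⁿ` (the projection of `H^{2n}(A, ℚ) ⊇
ℚhⁿ ⊕ W_K` onto `W_K`, extended by anything on the rest) kills `c_n(F′ − E′) = [Z]`. -/
theorem wPart_coeff_eq_zero {e f : ℕ} {l : Fin e → R} {m : Fin f → R} {h : R}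
    (hl : ∀ a, l a ∈ K ∙ h) (hm : ∀ i, m i ∈ K ∙ h) {Φ : R⟦X⟧} (hΦ : Φ * chernSplit l = chernSplit m)
    {W : Type*} [AddCommGroup W] [Module K W] (prW : R →ₗ[K] W) (n : ℕ) (hprW : prW (h ^ n) = 0) :
    prW (coeff n Φ) = 0 := by
  obtain ⟨α, hα⟩ := Submodule.mem_span_singleton.1 (coeff_virtualChern_mem_span_pow hl hm hΦ n)
  rw [← hα, map_smul, hprW, smul_zero]

end ClassReadout

/-! ## §5 Assembly: the NEG-#12-shaped sentence at every rung, and the rung `n = 6` -/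

section Assembly

variable {K : Type*} [CommRing K] {T : Type*} [AddCommGroup T] [Module K T] {H : Type*} [AddCommGroup H] [Module K H]
variable {NS : Type*} [AddCommGroup NS] [Module K NS]
variable {R : Type*} [CommRing R] [Algebra K R] {W : Type*} [AddCommGroup W] [Module K W]

open PowerSeries

/-- Transport of the line `K∙h` along a linear map (here: `NS_K ↪ H^{2•}(A, K)`). -/
theorem map_mem_span_singleton {x h : NS} (g : NS →ₗ[K] R) (hx : x ∈ K ∙ h) : g x ∈ K ∙ g h := by
  obtain ⟨α, rfl⟩ := Submodule.mem_span_singleton.1 hx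
  exact Submodule.mem_span_singleton.2 ⟨α, by rw [map_smul]⟩

/-- **All the named shapes of COROLLARY N″_n in one binder** (ATTEMPT-5 §3–§4; nothing in it is discharged here — these are
the paper inputs, typed).  Carriers: `T = H¹(A, T_A)`, `H = H^{0,2}(A)`, `NS = NS(A)_K` (`K = ℚ`) with the polarisation `h`
and its degree-2 inclusion `toR : NS → R = H^{2•}(A, K)`, the letters `cl : Fin e ⊕ Fin f → NS` (`l_a`, `m_i`), the
contraction `contr : NS → (T → H)` (`x ↦ (ξ ↦ ξ ⌟ x)`), the Weil directions `TW = T_oS ⊆ T`, the predicate `Deforms`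
(`ob_{Z/A} = 0`), the twisting letter `a₀`, a `W_K`-read-out `prW : R → W` vanishing on `K∙hⁿ`, and the class `classZ ∈ R`
of `Z`.  Scope binders `three_le : 3 ≤ n`, `rank_eq : f + 1 = e + n` (recorded, not used by the algebra).
Hypotheses: `steps` (THEOREM N″'s three shapes — Step 1 is file I's `injDeg_rel` + `diagonal_isScalar_iff` on the
paper inputs, Step 4 uses `injDeg_O` / `surjDeg_rel`); `u21` ((U2.1)_n + van Geemen 6.12: a class of `NS_K` killed by every
Weil direction lies on the line `K∙h` — true at every point of an `(n,n)` Weil-type component, `n ≥ 2`); `porteous`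
(Thom–Porteous after the twist by `N_{a₀}⁻¹`: `classZ = coeff n Φ` for the `Φ` with `Φ · c(E′) = c(F′)`, letters
`toR (x_p − l_{a₀})`); `Semiregular`, `ClassExact` as PROPOSITIONS with their one consequence `blochExact`
(`T_W ⊆ {ob = 0}`: Bloch 1972 (6.10) with `π ∘ ob = ⌟[Z]`, and the Hodge type of `h`, `W_K` along the Weil locus);
W-alive is read as `prW classZ ≠ 0`. -/
structure SplitPorteousShapes (n e f : ℕ) where
  /-- scope binder (not used by the algebra): the ledger of file I justifies Step 1 / Step 3 only for `n ≥ 3`. -/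
  three_le : 3 ≤ n
  /-- scope binder (not used by the algebra): `rk F = rk E + n − 1`, so that `codim D_{e−1}(φ) = f − e + 1 = n` and
  Thom–Porteous reads `[Z] = c_n(F − E)` (rung `n = 6`: `f = e + 5`). -/
  rank_eq : f + 1 = e + n
  /-- contraction `x ↦ (ξ ↦ ξ ⌟ x)`, `NS(A)_K → Hom(H¹(T_A), H^{0,2}(A))`. -/
  contr : NS →ₗ[K] T →ₗ[K] H
  /-- the letters: `inl a ↦ l_a = c₁(N_a)`, `inr i ↦ m_i = c₁(M_i)`. -/
  cl : Fin e ⊕ Fin f → NS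
  /-- the polarisation class. -/
  h : NS
  /-- `NS(A)_K → H^{2•}(A, K)` (degree-2 classes inside the even cohomology ring). -/
  toR : NS →ₗ[K] R
  /-- the Weil directions `T_W = T_oS ⊆ H¹(A, T_A)` (`n²` of the `4n²`). -/
  TW : Submodule K T
  /-- `Deforms ξ :⟺ ob_{Z/A}(ξ) = 0`. -/
  Deforms : T → Prop
  /-- the twisting letter (`N_1` in th-5). -/
  a₀ : Fin e
  /-- the `W_K`-read-out of `H^{2n}(A, K)`, zero on `K∙hⁿ`. -/
  prW : R →ₗ[K] W
  /-- the class `[Z] ∈ H^{2n}(A, K)`. -/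
  classZ : R
  /-- «`Z` is Bloch-semiregular» (proposition, not modelled). -/
  Semiregular : Prop
  /-- «`[Z] ∈ ℚhⁿ ⊕ W_K`» (proposition, not modelled). -/
  ClassExact : Prop
  steps : StepShapes (fun p => contr (cl p)) Deforms a₀
  blochExact : Semiregular → ClassExact → ∀ ξ ∈ TW, Deforms ξ
  u21 : ∀ x : NS, (∀ ξ ∈ TW, contr x ξ = 0) → x ∈ K ∙ h
  porteous : ∀ Φ : R⟦X⟧, Φ * chernSplit (fun a : Fin e => toR (cl (.inl a) - cl (.inl a₀))) =
    chernSplit (fun i : Fin f => toR (cl (.inr i) - cl (.inl a₀))) → classZ = coeff n Φ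
  prW_h_pow : prW (toR h ^ n) = 0

variable {n e f : ℕ}

/-- THEOREM N″_n inside the binder: `{ob = 0} = T^pair`. -/
theorem SplitPorteousShapes.deforms_iff
    (S : SplitPorteousShapes (K := K) (T := T) (H := H) (NS := NS) (R := R) (W := W) n e f) (ξ : T) :
    S.Deforms ξ ↔ ξ ∈ pairSpace fun p => S.contr (S.cl p) :=
  deforms_iff_mem_pairSpace S.steps ξ

/-- Under the shapes, «semiregular ∧ class-exact» puts every twisted letter `x_p − l_{a₀}` on the line `K∙h` in `R`. -/
theorem SplitPorteousShapes.letters_mem_span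
    (S : SplitPorteousShapes (K := K) (T := T) (H := H) (NS := NS) (R := R) (W := W) n e f)
    (hsr : S.Semiregular) (hce : S.ClassExact) (p : Fin e ⊕ Fin f) :
    S.toR (S.cl p - S.cl (.inl S.a₀)) ∈ K ∙ S.toR S.h :=
  map_mem_span_singleton S.toR (sub_base_mem_span_of_weil S.steps (S.blochExact hsr hce) S.u21 p)

/-- The class of `Z` lies on the line `K∙hⁿ` under the shapes and «semiregular ∧ class-exact» — the positive form of the
conclusion (what a W-track row prints as «W-part = 0»): `[Z] = c_n(F′ − E′) ∈ K∙hⁿ`. -/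
theorem SplitPorteousShapes.classZ_mem_span_pow
    (S : SplitPorteousShapes (K := K) (T := T) (H := H) (NS := NS) (R := R) (W := W) n e f)
    (hsr : S.Semiregular) (hce : S.ClassExact) : S.classZ ∈ K ∙ S.toR S.h ^ n := by
  obtain ⟨Φ, hΦ, -⟩ := existsUnique_virtualChern (fun a : Fin e => S.toR (S.cl (.inl a) - S.cl (.inl S.a₀)))
    (fun i : Fin f => S.toR (S.cl (.inr i) - S.cl (.inl S.a₀)))
  rw [S.porteous Φ hΦ]
  exact coeff_virtualChern_mem_span_pow (fun a => S.letters_mem_span hsr hce _)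
    (fun i => S.letters_mem_span hsr hce _) hΦ n

/-- **COROLLARY N″_n (the NEG-#12-shaped sentence at every rung).**  Under the named shapes, `Z` is NOT simultaneously
Bloch-semiregular, class-exact and W-alive: semiregular ∧ class-exact forces every letter difference onto `K∙h`
(`sub_base_mem_span_of_weil`), hence `[Z] = c_n(F′ − E′) ∈ K∙hⁿ` (`coeff_virtualChern_mem_span_pow`), hence
`prW [Z] = 0`. -/
theorem SplitPorteousShapes.not_semiregular_classExact_wAlive
    (S : SplitPorteousShapes (K := K) (T := T) (H := H) (NS := NS) (R := R) (W := W) n e f) :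
    ¬ (S.Semiregular ∧ S.ClassExact ∧ S.prW S.classZ ≠ 0) := by
  rintro ⟨hsr, hce, halive⟩
  apply halive
  obtain ⟨α, hα⟩ := Submodule.mem_span_singleton.1 (S.classZ_mem_span_pow hsr hce)
  rw [← hα, map_smul, S.prW_h_pow, smul_zero]

/-- **THE RUNG `n = 6`** (TRACK S4-PUSH (R-i); Weil-type 12-folds, `f = e + 5`, `Z` a smooth 6-fold, `[Z] ∈ H¹²`): file I's
ledger supplies every cohomological input of Steps 1–4 (`ledger_rung_six`: INJ₂/SURJ₁ for `T_{P/A}` and for `𝒪`), and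
under the named shapes no split Porteous locus `D_{e−1}(⊕_{a ≤ e} N_a → ⊕_{i ≤ e+5} M_i)` with (H1) is
«Bloch-semiregular ∧ class-exact ∧ W-alive»; its class lies on `K∙h⁶`. -/
theorem rung_six (e : ℕ) (he : 1 ≤ e)
    (S : SplitPorteousShapes (K := K) (T := T) (H := H) (NS := NS) (R := R) (W := W) 6 e (e + 5)) :
    ((∀ r, 1 ≤ r → ¬ SuppRel 6 e r (2 + r - 1)) ∧ (∀ j, 1 ≤ j → ¬ SuppRel 6 e j (1 + j)) ∧
      (∀ r, 1 ≤ r → ¬ SuppO 6 e r (2 + r - 1)) ∧ (∀ j, 1 ≤ j → ¬ SuppO 6 e j (1 + j))) ∧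
    ¬ (S.Semiregular ∧ S.ClassExact ∧ S.prW S.classZ ≠ 0) ∧
    (S.Semiregular → S.ClassExact → S.classZ ∈ K ∙ S.toR S.h ^ 6) :=
  ⟨⟨(ledger_rung_six e he).1, (ledger_rung_six e he).2.1, (ledger_rung_six e he).2.2.1, (ledger_rung_six e he).2.2.2.1⟩,
    S.not_semiregular_classExact_wAlive, S.classZ_mem_span_pow⟩

/-- NON-VACUITY WITNESS (referee check A1–A6): the named shapes are jointly satisfiable — a (degenerate) instance over
`K = ℚ` with all carriers `ℚ`, zero letters and `h = 1` (`n = 3`, `e = 1`, `f = 3`); so `not_semiregular_classExact_wAlive`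
is not a consequence of contradictory hypotheses.  (It is of course the GEOMETRY, on paper, that makes the shapes true of
a split Porteous locus; the kernel only composes them.) -/
example : SplitPorteousShapes (K := ℚ) (T := ℚ) (H := ℚ) (NS := ℚ) (R := ℚ) (W := ℚ) 3 1 3 where
  three_le := le_rfl
  rank_eq := rfl
  contr := 0
  cl := 0
  h := 1
  toR := LinearMap.id
  TW := ⊤
  Deforms := fun _ => True
  a₀ := 0
  prW := 0
  classZ := 0
  Semiregular := True
  ClassExact := True
  steps := ⟨fun _ _ _ _ => rfl, fun _ _ _ _ => rfl, fun _ _ => trivial⟩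
  blochExact := fun _ _ _ _ => trivial
  u21 := fun x _ => Submodule.mem_span_singleton.2 ⟨x, by simp⟩
  porteous := fun Φ hΦ => by
    have h1 : ∀ {r : ℕ}, chernSplit (0 : Fin r → ℚ) = 1 := by intro r; simp [chernSplit]
    simp only [Pi.zero_apply, sub_self, map_zero] at hΦ
    rw [show (fun _ : Fin 1 => (0 : ℚ)) = 0 from rfl, show (fun _ : Fin 3 => (0 : ℚ)) = 0 from rfl, h1, h1,
      mul_one] at hΦ
    rw [hΦ, coeff_one]; simp
  prW_h_pow := rfl

end Assembly

end Summit.Ventures.HSemireg.PorteousConfinement
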